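import Literature.AnabelianGeometry.SemiGraphs.BTempQDPairCoverPullback
import Literature.AnabelianGeometry.SemiGraphs.BTempQDPairCategoryP
import HarnessLib

/-!
# Semi-graphs of anabelioids, Appendix, proof of Theorem A.4: the COMPOSITION LAW on
# `Hom^((B, Γ_B), (C, Γ_C)) = lim_→ Hom̄((B′, Γ_B′), (C, Γ_C))` and its compatibility with `q`

Mochizuki, *Semi-graphs of anabelioids*, Publ. RIMS **42** (2006) 221–322, Appendix, proof of
Theorem A.4, manuscript p. 84 (PRIMS p. 314 ll. 1–8) [cite: MochizukiSemiAnbd2006, Thm A.4 proof p.84]: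
"Thus, we conclude that `Hom_{T_i}(B/Γ_B, C/Γ_C)` may be reconstructed as the following filtered
inductive limit: `Hom^((B, Γ_B), (C, Γ_C)) := lim_→ Hom̄((B′, Γ_B′), (C, Γ_C))` [i.e., over 1-proper
morphisms of strongly connected QD-pairs `(B′, Γ_B′) → (B, Γ_B)` and transition morphisms
`(B‴, Γ_B‴) → (B″, Γ_B″)` over `(B, Γ_B)`]. Moreover, one verifies immediately that this reconstruction
is compatible with composition of arrows."  (On p. 85 the category `P_i` has these `Hom^` as its
morphisms, so `Hom^` carries a composition law; print leaves it implicit.)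

Row **A4-lim-comp** of the abc-iut cell's `plan/L3/SUBDAG-SemiAnbd-Cor311.md` (holder abc-iut-w5-d129;
this file by wave-5 seat abc-iut-w5-d220), PART 2, for QD-pairs of the model temperoid `B^temp(Π)`
(`Π` any topological group; NO temperedness hypothesis), over abc-iut-w5-d129's `HomHat`/`homHatToHom`
(`BTempQDPairHomHat.lean`), PART 1 = the pulled-back cover `OneProperCover.pullbackAlong`
(`BTempQDPairCoverPullback.lean`), abc-iut-w4-d081's injectivity `homHatToHom_injective`
(`BTempQDPairCoversDirected.lean`) and parameter structure `HomHatCompLaw` / category `PCore κ`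
(`BTempQDPairCategoryP.lean`), and abc-iut-w4-d089's identity cover `OneProperCover.self` /
`homHatOfHom` (`QDPairHomHatTransport.lean`):

* `QDPair.Hom.IsOneProper.surjective` / `.exists_stabilizer_apply_eq` / **`.comp`**: in `B^temp(Π)`
  the composite of two 1-proper morphisms of QD-pairs is 1-proper (0-proper from surjectivity,
  `isZeroProper_of_surjective`; lifting composes; quotient clause by the criterion
  `isQuotient_iff_surjective`: lift, then correct by an element of `Ker(Γ₁ → Γ₂)`); hence the composite
  cover `OneProperCover.trans` and its structure transition `transTransition`;
* **THE INTRINSIC COMPOSITION LAW** `QDPair.HomHat.comp : Hom^(B, C) → Hom^(C, D) → Hom^(B, D)`, defined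
  ON REPRESENTATIVES (`HomHat.compRep`, `HomHat.comp_mk_mk` is `rfl`):
  `[(c : B′ → B, f̄)] ∘ [(d : C′ → C, ḡ)] := [(B″ → B′ → B, (B″ → C′ → D)‾)]` where
  `(B″, Γ_B″) → (B′, Γ_B′)` is the pull-back of `d` along `f` and `B″ → C′` its second projection —
  well defined on classes because the comparison map `Hom^ → Hom_T` is injective and takes the same
  value on all representatives (`toHom_trans_of_sq`: `q` is functorial and inverts 1-proper arrows);
* **"compatible with composition of arrows"**: `QDPair.HomHat.homHatToHom_comp :
  homHatToHom (x.comp y) = homHatToHom x ≫ homHatToHom y`; consequences (all through the injection):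
  `comp_assoc`, the unit laws for `homHatOfHom hP (𝟙 _)`, `homHatOfHom_comp_homHatOfHom`
  (`f ↦ [(id, f̄)]` is multiplicative), `comp_homHatOfHom` (composition with `[(id, ḡ)]` is
  post-composition), `comp_mk_mk_eq_of_sq` (ANY commutative square over `f`, `d` computes the
  composite — independence of the refinement) and `comp_unique` (ANY law compatible with `q` is this
  one);
* **`QDPair.HomHatCompLaw.intrinsic : HomHatCompLaw Π`** — the parameter of `BTempQDPairCategoryP.lean`
  INSTANTIATED for EVERY topological group `Π` (the file's own instance `HomHatCompLaw.transported`
  needs `Π` tempered and is, by `HomHatCompLaw.unique`, equal to this one: `HomHatCompLaw.eq_intrinsic`);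
  hence the category `PCore HomHatCompLaw.intrinsic` of strongly connected QD-pairs with `Hom^` as
  morphisms exists unconditionally, and `κ.comp = HomHat.comp` for any law `κ` (`HomHatCompLaw.comp_eq_comp`).

This closes row A4-lim-comp and feeds row A4-lim-P (the category `P_i`, seat abc-iut-w4-d081) by name.
Elementary `Π`-set theory; nothing refers to the IUT corpus and no side is taken on any disputed claim.
-/

open CategoryTheory

namespace Literature.AnabelianGeometry.SemiGraphs

universe u

namespace QDPair

variable {G : Type u} [Group G] [TopologicalSpace G] [IsTopologicalGroup G]

/-! ### 1-proper morphisms of QD-pairs of `B^temp(Π)`: points, and composition -/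

/-- A 1-proper morphism of QD-pairs of `B^temp(Π)` is surjective on points (its quotient clause).
[cite: MochizukiSemiAnbd2006, Def A.3(iv) p.82] -/
theorem Hom.IsOneProper.surjective {P₁ P₂ : QDPair (BTemp G)} {f : P₁ ⟶ P₂}
    (hf : Hom.IsOneProper f) :
    Function.Surjective fun x : P₁.A.obj.V => (f.hom.hom.hom x : P₂.A.obj.V) :=
  IsQuotient.surjective (P := (⟨P₁.A, Hom.stabilizer f⟩ : QDPair (BTemp G))) hf.2.2

/-- Two points with the same image under a 1-proper morphism differ by an element of the kernel
`Ker(Γ₁ → Γ₂) = Stab_{Γ₁}(φ)` (the quotient clause, on points). [cite: MochizukiSemiAnbd2006, Def A.3(iv) p.82] -/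
theorem Hom.IsOneProper.exists_stabilizer_apply_eq {P₁ P₂ : QDPair (BTemp G)} {f : P₁ ⟶ P₂}
    (hf : Hom.IsOneProper f) {x y : P₁.A.obj.V}
    (h : (f.hom.hom.hom x : P₂.A.obj.V) = f.hom.hom.hom y) :
    ∃ k ∈ Hom.stabilizer f, (k.hom.hom.hom x : P₁.A.obj.V) = y :=
  (IsQuotient.apply_eq_iff (P := (⟨P₁.A, Hom.stabilizer f⟩ : QDPair (BTemp G))) hf.2.2).mp h

/-- **In `B^temp(Π)` the composite of two 1-proper morphisms of QD-pairs is 1-proper**: 0-proper since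
surjective on points; every `γ₃ ∈ Γ₃` lifts to `Γ₂` and then to `Γ₁`; and `A₁ → A₃` forms a quotient of
`(A₁, Stab_{Γ₁}(φ ≫ ψ))` by the criterion — if `ψ φ x = ψ φ y`, then `γ₂ (φ x) = φ y` for some
`γ₂ ∈ Stab_{Γ₂}(ψ)`, which lifts to `γ₁ ∈ Γ₁`; then `φ (γ₁ x) = φ y`, so `k (γ₁ x) = y` for some
`k ∈ Stab_{Γ₁}(φ)`, and `k γ₁` stabilises `φ ≫ ψ`. (Used in the proof of Thm. A.4 to compose 1-proper
covers.) [cite: MochizukiSemiAnbd2006, Thm A.4 proof p.84] -/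
theorem Hom.IsOneProper.comp {P₁ P₂ P₃ : QDPair (BTemp G)} {f : P₁ ⟶ P₂} {g : P₂ ⟶ P₃}
    (hf : Hom.IsOneProper f) (hg : Hom.IsOneProper g) : Hom.IsOneProper (f ≫ g) := by
  have hsurj : Function.Surjective fun x : P₁.A.obj.V => ((f ≫ g).hom.hom.hom x : P₃.A.obj.V) :=
    fun z => by
      obtain ⟨y, rfl⟩ := hg.surjective z
      obtain ⟨x, rfl⟩ := hf.surjective y
      exact ⟨x, rfl⟩
  refine ⟨isZeroProper_of_surjective _ hsurj, ?_, ?_⟩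
  · intro γ₃ hγ₃
    obtain ⟨γ₂, hγ₂, h₂⟩ := hg.2.1 γ₃ hγ₃
    obtain ⟨γ₁, hγ₁, h₁⟩ := hf.2.1 γ₂ hγ₂
    refine ⟨γ₁, hγ₁, ?_⟩
    change (f.hom ≫ g.hom) ≫ γ₃.hom = γ₁.hom ≫ f.hom ≫ g.hom
    rw [Category.assoc, h₂, ← Category.assoc, h₁, Category.assoc]
  · refine (isQuotient_iff_surjective _).mpr ⟨fun γ hγ => hγ.2, hsurj, ?_⟩
    intro x y hxy
    change (g.hom.hom.hom (f.hom.hom.hom x) : P₃.A.obj.V) = g.hom.hom.hom (f.hom.hom.hom y) at hxy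
    obtain ⟨γ₂, hγ₂, hγ₂x⟩ := hg.exists_stabilizer_apply_eq hxy
    obtain ⟨γ₁, hγ₁, h₁⟩ := hf.2.1 γ₂ hγ₂.1
    -- `φ (γ₁ x) = γ₂ (φ x) = φ y`
    have hfx : (f.hom.hom.hom (γ₁.hom.hom.hom x) : P₂.A.obj.V) = f.hom.hom.hom y := by
      rw [← hγ₂x]
      exact (congrArg (fun φ : P₁.A ⟶ P₂.A => (φ.hom.hom x : P₂.A.obj.V)) h₁).symm
    obtain ⟨k, hk, hkx⟩ := hf.exists_stabilizer_apply_eq hfx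
    refine ⟨k * γ₁, ⟨P₁.Γ.mul_mem hk.1 hγ₁, ?_⟩, hkx⟩
    change (γ₁.hom ≫ k.hom) ≫ f.hom ≫ g.hom = f.hom ≫ g.hom
    calc (γ₁.hom ≫ k.hom) ≫ f.hom ≫ g.hom = γ₁.hom ≫ (k.hom ≫ f.hom) ≫ g.hom := by
          simp only [Category.assoc]
      _ = (γ₁.hom ≫ f.hom) ≫ g.hom := by rw [hk.2, Category.assoc]
      _ = f.hom ≫ γ₂.hom ≫ g.hom := by rw [← h₁, Category.assoc]
      _ = f.hom ≫ g.hom := by rw [hγ₂.2]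

namespace OneProperCover

/-! ### Composite covers -/

/-- **The composite 1-proper cover** `(B″, Γ_B″) → (B′, Γ_B′) → (B, Γ_B)` of a 1-proper cover of the
source of a 1-proper cover (1-proper by `Hom.IsOneProper.comp`). [cite: MochizukiSemiAnbd2006, Thm A.4 proof p.84] -/
@[reducible] noncomputable def trans {P : QDPair (BTemp G)} (c : OneProperCover P)
    (e : OneProperCover c.src) : OneProperCover P where
  src := e.src
  hom := e.hom ≫ c.hom
  isStronglyConnected := e.isStronglyConnected
  isOneProper := e.isOneProper.comp c.isOneProper

/-- The composite cover on arrows. [cite: MochizukiSemiAnbd2006, Thm A.4 proof p.84] -/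
@[simp] theorem trans_hom {P : QDPair (BTemp G)} (c : OneProperCover P) (e : OneProperCover c.src) :
    (c.trans e).hom = e.hom ≫ c.hom := rfl

/-- The composite cover has the same source as `e`. [cite: MochizukiSemiAnbd2006, Thm A.4 proof p.84] -/
@[simp] theorem trans_src {P : QDPair (BTemp G)} (c : OneProperCover P) (e : OneProperCover c.src) :
    (c.trans e).src = e.src := rfl

/-- The structure morphism `e` is a transition `(B″, Γ_B″) → (B′, Γ_B′)` over `(B, Γ_B)` from the
composite cover to `c`. [cite: MochizukiSemiAnbd2006, Thm A.4 proof p.84] -/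
noncomputable def transTransition {P : QDPair (BTemp G)} (c : OneProperCover P)
    (e : OneProperCover c.src) : Transition (c.trans e) c :=
  ⟨e.hom, rfl, e.isOneProper⟩

/-- The transition of the composite cover is `e`. [cite: MochizukiSemiAnbd2006, Thm A.4 proof p.84] -/
@[simp] theorem transTransition_hom {P : QDPair (BTemp G)} (c : OneProperCover P)
    (e : OneProperCover c.src) : (c.transTransition e).hom = e.hom := rfl

/-- Restricting a class along the composite cover: `[(B″, (e ≫ f)‾)] = [(B′, f̄)]` in `Hom^`.
[cite: MochizukiSemiAnbd2006, Thm A.4 proof p.84] -/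
theorem homHatMk_trans {P C : QDPair (BTemp G)} (c : OneProperCover P) (e : OneProperCover c.src)
    (f : c.src ⟶ C) : homHatMk (c.trans e) (homBarMk (e.hom ≫ f)) = homHatMk c (homBarMk f) := by
  rw [← HomBar.precomp_mk, ← transTransition_hom, homHatMk_precomp]

/-- **The value of `q` on a composite index**: for a cover `e` of the source `B′` of the cover `c` of `B`,
a morphism `s : B″ → C′` into the source of a cover `d` of `C` and a square `s ≫ d = e ≫ f`,
`(q(B″ → B′ → B))⁻¹ ≫ q(s ≫ g) = ((q c)⁻¹ ≫ q f) ≫ ((q d)⁻¹ ≫ q g)` (`q` is a functor inverting 1-proper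
arrows). [cite: MochizukiSemiAnbd2006, Thm A.4 proof p.84] -/
theorem toHom_trans_of_sq {P C D : QDPair (BTemp G)} (c : OneProperCover P) (f : c.src ⟶ C)
    (d : OneProperCover C) (g : d.src ⟶ D) (e : OneProperCover c.src) (s : e.src ⟶ d.src)
    (w : s ≫ d.hom = e.hom ≫ f) :
    (c.trans e).toHom (homBarMk (s ≫ g)) = c.toHom (homBarMk f) ≫ d.toHom (homBarMk g) := by
  haveI := isIso_orbitQuotientMap_of_isOneProper c.hom c.isOneProper
  haveI := isIso_orbitQuotientMap_of_isOneProper d.hom d.isOneProper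
  haveI := isIso_orbitQuotientMap_of_isOneProper e.hom e.isOneProper
  haveI := isIso_orbitQuotientMap_of_isOneProper (c.trans e).hom (c.trans e).isOneProper
  rw [OneProperCover.toHom_mk, OneProperCover.toHom_mk, OneProperCover.toHom_mk, IsIso.inv_comp_eq]
  have h₁ : orbitQuotientMap (c.trans e).hom = orbitQuotientMap e.hom ≫ orbitQuotientMap c.hom :=
    (orbitQuotientFunctor (G := G)).map_comp e.hom c.hom
  have h₂ : orbitQuotientMap (s ≫ g) = orbitQuotientMap s ≫ orbitQuotientMap g :=
    (orbitQuotientFunctor (G := G)).map_comp s g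
  have h₃ : orbitQuotientMap s ≫ orbitQuotientMap d.hom = orbitQuotientMap e.hom ≫ orbitQuotientMap f := by
    have hw : orbitQuotientMap (s ≫ d.hom) = orbitQuotientMap s ≫ orbitQuotientMap d.hom :=
      (orbitQuotientFunctor (G := G)).map_comp s d.hom
    have hw' : orbitQuotientMap (e.hom ≫ f) = orbitQuotientMap e.hom ≫ orbitQuotientMap f :=
      (orbitQuotientFunctor (G := G)).map_comp e.hom f
    rw [← hw, ← hw', w]
  have h₄ : orbitQuotientMap s =
      (orbitQuotientMap e.hom ≫ orbitQuotientMap f) ≫ inv (orbitQuotientMap d.hom) := by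
    rw [IsIso.eq_comp_inv]
    exact h₃
  rw [h₂, h₁, h₄]
  simp only [Category.assoc, IsIso.hom_inv_id_assoc]

end OneProperCover

/-! ### `q` on identities and composites, with the objects spelled `B/Γ_B` -/

/-- `q(𝟙_{(B, Γ_B)}) = 𝟙_{B/Γ_B}` (functoriality of `q`). [cite: MochizukiSemiAnbd2006, Thm A.4 proof p.83] -/
theorem orbitQuotientMap_id (P : QDPair (BTemp G)) : orbitQuotientMap (𝟙 P) = 𝟙 P.orbitQuotient :=
  (orbitQuotientFunctor (G := G)).map_id P

/-- `q(f ≫ g) = q(f) ≫ q(g)` (functoriality of `q`). [cite: MochizukiSemiAnbd2006, Thm A.4 proof p.83] -/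
theorem orbitQuotientMap_comp {P₁ P₂ P₃ : QDPair (BTemp G)} (f : P₁ ⟶ P₂) (g : P₂ ⟶ P₃) :
    orbitQuotientMap (f ≫ g) = orbitQuotientMap f ≫ orbitQuotientMap g :=
  (orbitQuotientFunctor (G := G)).map_comp f g

/-! ### The composition law on `Hom^` -/

namespace HomHat

variable {P C D : QDPair (BTemp G)}

/-- **Composition on representatives**: `(c : B′ → B, f : B′ → C) ∘ (d : C′ → C, g : C′ → D) :=
[(B″ → B′ → B, (B″ → C′ → D)‾)]`, where `(B″, Γ_B″) → (B′, Γ_B′)` is the pull-back of the 1-proper cover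
`d` along `f` and `B″ → C′` its second projection. [cite: MochizukiSemiAnbd2006, Thm A.4 proof p.84] -/
noncomputable def compRep (c : OneProperCover P) (f : c.src ⟶ C) (d : OneProperCover C)
    (g : d.src ⟶ D) : HomHat P D :=
  homHatMk (c.trans (d.pullbackAlong f c.isStronglyConnected))
    (homBarMk (OneProperCover.pullbackAlongSnd d f c.isStronglyConnected ≫ g))

/-- The comparison map on the composite representative is the composite of the comparison maps.
[cite: MochizukiSemiAnbd2006, Thm A.4 proof p.84] -/
theorem homHatToHom_compRep (c : OneProperCover P) (f : c.src ⟶ C) (d : OneProperCover C)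
    (g : d.src ⟶ D) :
    homHatToHom P D (compRep c f d g) = c.toHom (homBarMk f) ≫ d.toHom (homBarMk g) :=
  OneProperCover.toHom_trans_of_sq c f d g _ _ (OneProperCover.pullbackAlong_w d f c.isStronglyConnected)

/-- Composition on representatives of the index with CLASSES `f̄ ∈ Hom̄(B′, C)`, `ḡ ∈ Hom̄(C′, D)` (well
defined: `Γ`-translates have the same comparison map, and `Hom^ → Hom_T` is injective).
[cite: MochizukiSemiAnbd2006, Thm A.4 proof p.84] -/
noncomputable def compSigma (a : Σ c : OneProperCover P, HomBar c.src C)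
    (b : Σ d : OneProperCover C, HomBar d.src D) : HomHat P D :=
  Quotient.liftOn₂' a.2 b.2 (fun f g => compRep a.1 f b.1 g) (by
    intro f₁ g₁ f₂ g₂ hf hg
    apply homHatToHom_injective P D
    rw [homHatToHom_compRep, homHatToHom_compRep,
      show homBarMk f₁ = homBarMk f₂ from Quotient.sound hf,
      show homBarMk g₁ = homBarMk g₂ from Quotient.sound hg])

/-- The comparison map on `compSigma`. [cite: MochizukiSemiAnbd2006, Thm A.4 proof p.84] -/
theorem homHatToHom_compSigma (a : Σ c : OneProperCover P, HomBar c.src C)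
    (b : Σ d : OneProperCover C, HomBar d.src D) :
    homHatToHom P D (compSigma a b) =
      homHatToHom P C (homHatMk a.1 a.2) ≫ homHatToHom C D (homHatMk b.1 b.2) := by
  obtain ⟨c, x⟩ := a
  obtain ⟨d, y⟩ := b
  induction x using Quotient.ind with
  | _ f =>
    induction y using Quotient.ind with
    | _ g => exact homHatToHom_compRep c f d g

/-- **The composition law `Hom^((B, Γ_B), (C, Γ_C)) × Hom^((C, Γ_C), (D, Γ_D)) → Hom^((B, Γ_B), (D, Γ_D))`**
(diagrammatic order: `x.comp y` is "`x` then `y`"), defined on representatives by pulling back the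
cover of the second factor along the arrow of the first (`comp_mk_mk`); independent of the
representatives because the comparison map `Hom^ → Hom_T` is injective (`homHatToHom_injective`) and
constant on classes. [cite: MochizukiSemiAnbd2006, Thm A.4 proof p.84] -/
noncomputable def comp : HomHat P C → HomHat C D → HomHat P D :=
  Quot.lift₂ (r := HomHatRel P C) (s := HomHatRel C D) compSigma
    (fun a b₁ b₂ h => homHatToHom_injective P D (by
      rw [homHatToHom_compSigma, homHatToHom_compSigma,
        show homHatMk b₁.1 b₁.2 = homHatMk b₂.1 b₂.2 from Quot.sound h]))
    (fun a₁ a₂ b h => homHatToHom_injective P D (by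
      rw [homHatToHom_compSigma, homHatToHom_compSigma,
        show homHatMk a₁.1 a₁.2 = homHatMk a₂.1 a₂.2 from Quot.sound h]))

/-- **The composition law on representatives** (definitional).
[cite: MochizukiSemiAnbd2006, Thm A.4 proof p.84] -/
theorem comp_mk_mk (c : OneProperCover P) (f : c.src ⟶ C) (d : OneProperCover C) (g : d.src ⟶ D) :
    comp (homHatMk c (homBarMk f)) (homHatMk d (homBarMk g)) =
      homHatMk (c.trans (d.pullbackAlong f c.isStronglyConnected))
        (homBarMk (OneProperCover.pullbackAlongSnd d f c.isStronglyConnected ≫ g)) := rfl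

/-- **"This reconstruction is compatible with composition of arrows"**: the comparison map
`Hom^ → Hom_T` takes composites to composites. [cite: MochizukiSemiAnbd2006, Thm A.4 proof p.84] -/
theorem homHatToHom_comp (x : HomHat P C) (y : HomHat C D) :
    homHatToHom P D (comp x y) = homHatToHom P C x ≫ homHatToHom C D y := by
  induction x using Quot.ind with
  | _ a =>
    induction y using Quot.ind with
    | _ b => exact homHatToHom_compSigma a b

/-- **Any commutative square over `f` and `d` computes the composite**: for EVERY 1-proper cover
`e : (B″, Γ_B″) → (B′, Γ_B′)` and morphism `s : B″ → C′` with `s ≫ d = e ≫ f` (not only the chosen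
pull-back), `[(B′, f̄)] ∘ [(C′, ḡ)] = [(B″ → B′ → B, (s ≫ g)‾)]` — the independence of the composite
from the refinement used (what a functor preserving 1-proper covers and such squares needs in order
to respect `comp`). [cite: MochizukiSemiAnbd2006, Thm A.4 proof p.84] -/
theorem comp_mk_mk_eq_of_sq (c : OneProperCover P) (f : c.src ⟶ C) (d : OneProperCover C)
    (g : d.src ⟶ D) (e : OneProperCover c.src) (s : e.src ⟶ d.src) (w : s ≫ d.hom = e.hom ≫ f) :
    comp (homHatMk c (homBarMk f)) (homHatMk d (homBarMk g)) =
      homHatMk (c.trans e) (homBarMk (s ≫ g)) :=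
  homHatToHom_injective P D (by
    rw [homHatToHom_comp, homHatToHom_mk, homHatToHom_mk, homHatToHom_mk,
      OneProperCover.toHom_trans_of_sq c f d g e s w])

/-- **Uniqueness**: any composition law on `Hom^` compatible with `q` IS `comp` (the comparison map is
injective). [cite: MochizukiSemiAnbd2006, Thm A.4 proof p.84] -/
theorem comp_unique (F : HomHat P C → HomHat C D → HomHat P D)
    (hF : ∀ x y, homHatToHom P D (F x y) = homHatToHom P C x ≫ homHatToHom C D y)
    (x : HomHat P C) (y : HomHat C D) : F x y = comp x y :=
  homHatToHom_injective P D (by rw [hF, homHatToHom_comp])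

/-- **Associativity** of the composition law (through the injection into `Hom_T`).
[cite: MochizukiSemiAnbd2006, Thm A.4 proof p.84] -/
theorem comp_assoc {E : QDPair (BTemp G)} (x : HomHat P C) (y : HomHat C D) (z : HomHat D E) :
    comp (comp x y) z = comp x (comp y z) :=
  homHatToHom_injective P E (by simp only [homHatToHom_comp, Category.assoc])

/-! ### Units: the classes `[(id, f̄)]` of genuine morphisms of QD-pairs -/

/-- **Left unit**: `[(id, 1̄)] ∘ x = x`. [cite: MochizukiSemiAnbd2006, Thm A.4 proof p.84] -/
theorem id_comp (hP : P.IsStronglyConnected) (x : HomHat P C) : comp (homHatOfHom hP (𝟙 P)) x = x :=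
  homHatToHom_injective P C (by
    rw [homHatToHom_comp, homHatToHom_homHatOfHom, orbitQuotientMap_id, Category.id_comp])

/-- **Right unit**: `x ∘ [(id, 1̄)] = x`. [cite: MochizukiSemiAnbd2006, Thm A.4 proof p.84] -/
theorem comp_id (hC : C.IsStronglyConnected) (x : HomHat P C) : comp x (homHatOfHom hC (𝟙 C)) = x :=
  homHatToHom_injective P C (by
    rw [homHatToHom_comp, homHatToHom_homHatOfHom, orbitQuotientMap_id, Category.comp_id])

/-- **`f ↦ [(id, f̄)]` is multiplicative**: `[(id, f̄)] ∘ [(id, ḡ)] = [(id, (f ≫ g)‾)]` (the functor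
`D_i → P_i` of p. 85 on composites). [cite: MochizukiSemiAnbd2006, Thm A.4 proof pp.84-85] -/
theorem homHatOfHom_comp_homHatOfHom (hP : P.IsStronglyConnected) (hC : C.IsStronglyConnected)
    (f : P ⟶ C) (g : C ⟶ D) :
    comp (homHatOfHom hP f) (homHatOfHom hC g) = homHatOfHom hP (f ≫ g) :=
  homHatToHom_injective P D (by
    rw [homHatToHom_comp, homHatToHom_homHatOfHom, homHatToHom_homHatOfHom,
      homHatToHom_homHatOfHom, orbitQuotientMap_comp])

/-- **Composition with `[(id, ḡ)]` is post-composition**: `[(B′, f̄)] ∘ [(id, ḡ)] = [(B′, (f ≫ g)‾)]`.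
[cite: MochizukiSemiAnbd2006, Thm A.4 proof p.84] -/
theorem comp_homHatOfHom (c : OneProperCover P) (f : c.src ⟶ C) (hC : C.IsStronglyConnected)
    (g : C ⟶ D) : comp (homHatMk c (homBarMk f)) (homHatOfHom hC g) = homHatMk c (homBarMk (f ≫ g)) :=
  homHatToHom_injective P D (by
    haveI := isIso_orbitQuotientMap_of_isOneProper c.hom c.isOneProper
    rw [homHatToHom_comp, homHatToHom_homHatOfHom, homHatToHom_mk, homHatToHom_mk,
      OneProperCover.toHom_mk, OneProperCover.toHom_mk, Category.assoc, orbitQuotientMap_comp])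

/-- **Composition of a genuine cover-representative with anything, restricted along a transition**:
the class of the composite does not depend on refining the first index —
`[(B″, (t ≫ f)‾)] ∘ y = [(B′, f̄)] ∘ y`. [cite: MochizukiSemiAnbd2006, Thm A.4 proof p.84] -/
theorem comp_precomp {c c' : OneProperCover P} (t : OneProperCover.Transition c c')
    (x : HomBar c'.src C) (y : HomHat C D) :
    comp (homHatMk c (HomBar.precomp t.hom x)) y = comp (homHatMk c' x) y := by
  rw [homHatMk_precomp]

end HomHat

/-! ### The parameter of `BTempQDPairCategoryP.lean`, instantiated -/

/-- **Print's composition law on `Hom^`, packaged as the `HomHatCompLaw` of `BTempQDPairCategoryP.lean`**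
— for EVERY topological group `Π` (no temperedness): `comp := HomHat.comp` (restricted to strongly
connected triples), compatible with `q` by `HomHat.homHatToHom_comp`.
[cite: MochizukiSemiAnbd2006, Thm A.4 proof p.84] -/
noncomputable def HomHatCompLaw.intrinsic : HomHatCompLaw G where
  comp := @fun _ _ _ _ _ _ x y => HomHat.comp x y
  homHatToHom_comp := @fun _ _ _ _ _ _ x y => HomHat.homHatToHom_comp x y

/-- Every composition law on `Hom^` compatible with `q` IS the intrinsic one (`HomHatCompLaw.unique`);
in particular `HomHatCompLaw.transported hG = HomHatCompLaw.intrinsic` for `Π` tempered.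
[cite: MochizukiSemiAnbd2006, Thm A.4 proof p.84] -/
theorem HomHatCompLaw.eq_intrinsic (κ : HomHatCompLaw G) : κ = HomHatCompLaw.intrinsic :=
  κ.unique _

/-- On arrows: `κ.comp x y = HomHat.comp x y` for any law `κ` compatible with `q`.
[cite: MochizukiSemiAnbd2006, Thm A.4 proof p.84] -/
theorem HomHatCompLaw.comp_eq_comp (κ : HomHatCompLaw G) {P₁ P₂ P₃ : QDPair (BTemp G)}
    (h₁ : P₁.IsStronglyConnected) (h₂ : P₂.IsStronglyConnected) (h₃ : P₃.IsStronglyConnected)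
    (x : HomHat P₁ P₂) (y : HomHat P₂ P₃) : κ.comp h₁ h₂ h₃ x y = HomHat.comp x y :=
  HomHat.comp_unique _ (κ.homHatToHom_comp h₁ h₂ h₃) x y

/-- In the category `PCore κ` of `BTempQDPairCategoryP.lean` (objects: strongly connected QD-pairs;
morphisms: `Hom^`), composition is `HomHat.comp` — for any parameter `κ`, in particular for
`HomHatCompLaw.intrinsic`, which makes `PCore` available for every topological group `Π`.
[cite: MochizukiSemiAnbd2006, Thm A.4 proof p.85] -/
theorem PCore.comp_eq {κ : HomHatCompLaw G} {P₁ P₂ P₃ : PCore κ} (x : P₁ ⟶ P₂) (y : P₂ ⟶ P₃) :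
    x ≫ y = HomHat.comp (P := P₁.pair) (C := P₂.pair) (D := P₃.pair) x y :=
  HomHatCompLaw.comp_eq_comp κ P₁.isStronglyConnected P₂.isStronglyConnected P₃.isStronglyConnected x y

end QDPair

end Literature.AnabelianGeometry.SemiGraphs
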